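import Summits.Langlands.Langlands.Theorems.CliffordTateStructureTateLift
import Summits.Langlands.Langlands.Theorems.CliffordTateStructureKronecker
import Summits.Langlands.Langlands.Theorems.CliffordTateStructureKroneckerHom
import Summits.Langlands.Langlands.Theorems.CliffordTateStructureKroneckerIrreducible
import Literature.NumberTheory.GaloisRepresentations.CliffordInducedPrimeIndexConj
import HarnessLib

/-!
# Clifford–Tate structure: the Artin–Kronecker factorisation in the isotypic case

Let `ρ : Γ_K → GL_n(ℚ̄_ℓ)` be irreducible and `N ◁ Γ_K` open of finite index with `ρ|_N`
isotypic, not irreducible and not scalar.  Then `ρ` is conjugate to a Kronecker product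
`ρ₁ ⊗ ρ₂` of GENUINE continuous representations with `ρ₁, ρ₂` irreducible of ranks `a, d ≥ 2`
and `ρ₂` of finite image (`exists_kroneckerFactors`).

Proof.  The Kronecker frame of `ρ|_N ≅ S^{⊕ d}` (`exists_kroneckerFrame`) exhibits every `ρ(γ)`
as `X(γ) ⊗ Y(γ)`; `γ ↦ [Y(γ)]` is a projective representation trivial on `N`
(`exists_projectiveFactor`), hence continuous with finite image; Tate's theorem
`H²(Γ_K, ℚ/ℤ) = 0` lifts it to a genuine `ρ₂` with finite image
(`exists_framedGaloisRep_lift_of_finite_range`); the complementary factor is then a genuine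
continuous `ρ₁` (`exists_leftFactor`, `continuous_leftFactor`); both act irreducibly
(`left_factor_irreducible`, `right_factor_irreducible`); `d = 1` would make `ρ|_N` irreducible and
`a = 1` would make `N` act by scalars.
[cite: Clifford1937, Thm. 2–3] [cite: Patrikis2019, Prop. 4.1.1]
[cite: SerreDurham1977, §6.1 Thm. 4 (Tate)]
-/

set_option autoImplicit false
set_option linter.dupNamespace false

noncomputable section

namespace Summit.Langlands.Langlands.Theorems

open Matrix Field
open Literature.NumberTheory.GaloisRepresentations
open scoped Kronecker MatrixGroups

/-- `toMatrix'` of the standard representation attached to a framed representation. [folklore] -/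
theorem toMatrix'_toRepresentation {G : Type*} [Group G] [TopologicalSpace G] {A : Type*}
    [CommRing A] [TopologicalSpace A] {n : ℕ} (ρ : FramedRep G A n) (g : G) :
    LinearMap.toMatrix' (FramedRep.toRepresentation ρ g) =
      ((ρ g : GL (Fin n) A) : Matrix (Fin n) (Fin n) A) := by
  have h1 : FramedRep.toRepresentation ρ g =
      Matrix.toLin' ((ρ g : GL (Fin n) A) : Matrix (Fin n) (Fin n) A) := by
    apply LinearMap.ext
    intro v
    rw [FramedRep.toRepresentation_apply_apply, Matrix.toLin'_apply]
  rw [h1, LinearMap.toMatrix'_toLin']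

/-- Irreducibility of a framed representation from irreducibility of its matrix family.
[folklore] -/
theorem isIrreducible_toRepresentation_of_forall_submodule {G : Type*} [Group G]
    [TopologicalSpace G] {A : Type*} [Field A] [TopologicalSpace A] [IsTopologicalRing A] {n : ℕ}
    (hn : 0 < n) (ρ : FramedRep G A n)
    (h : ∀ W : Submodule A (Fin n → A),
      (∀ g, ∀ w ∈ W, ((ρ g : GL (Fin n) A) : Matrix (Fin n) (Fin n) A) *ᵥ w ∈ W) → W = ⊥ ∨ W = ⊤) :
    (FramedRep.toRepresentation ρ).IsIrreducible := by
  haveI : Nonempty (Fin n) := ⟨⟨0, hn⟩⟩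
  haveI : Nontrivial (Subrepresentation (FramedRep.toRepresentation ρ)) := by
    refine ⟨⟨⊥, ⊤, fun hbt => ?_⟩⟩
    have h1 := congrArg Subrepresentation.toSubmodule hbt
    exact bot_ne_top (h1 : (⊥ : Submodule A (Fin n → A)) = ⊤)
  refine ⟨fun W => ?_⟩
  rcases h W.toSubmodule (fun g w hw => by
      have h1 := W.apply_mem_toSubmodule g hw
      rwa [FramedRep.toRepresentation_apply_apply] at h1) with hW | hW
  · left
    apply Subrepresentation.toSubmodule_injective
    change W.toSubmodule = (⊥ : Subrepresentation (FramedRep.toRepresentation ρ)).toSubmodule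
    exact hW
  · right
    apply Subrepresentation.toSubmodule_injective
    change W.toSubmodule = (⊤ : Subrepresentation (FramedRep.toRepresentation ρ)).toSubmodule
    exact hW

set_option maxHeartbeats 1600000 in
set_option backward.isDefEq.respectTransparency false in
/-- **Artin–Kronecker factorisation of an irreducible Galois representation with isotypic,
non-irreducible, non-scalar restriction to an open normal subgroup.**  There are continuous
`ρ₁ : Γ_K → GL_a(ℚ̄_ℓ)`, `ρ₂ : Γ_K → GL_d(ℚ̄_ℓ)`, both irreducible, `a, d ≥ 2`, `n = a d`, `ρ₂` of
finite image, and a frame change `Q` with `Q ρ(γ) Q⁻¹ = ρ₁(γ) ⊗ ρ₂(γ)` (up to the relabelling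
`Fin a × Fin d ≃ Fin n`). [cite: Clifford1937, Thm. 2–3] [cite: Patrikis2019, Prop. 4.1.1]
[cite: SerreDurham1977, §6.1 Thm. 4 (Tate)] -/
theorem exists_kroneckerFactors (K : Type) [Field K] [NumberField K] (n ℓ : ℕ) [Fact ℓ.Prime]
    (ρ : FramedGaloisRep K (PadicAlgCl ℓ) n) (hirr : ρ.toGaloisRep.IsIrreducible)
    (N : Subgroup (absoluteGaloisGroup K)) [N.Normal] [N.FiniteIndex]
    (hNo : IsOpen (N : Set (absoluteGaloisGroup K)))
    (hiso : IsIsotypic (MonoidAlgebra (PadicAlgCl ℓ) N) (resN (FramedRep.toRepresentation ρ) N).asModule)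
    (hNirr : ¬ (resN (FramedRep.toRepresentation ρ) N).IsIrreducible)
    (hNsc : ¬ ∀ g ∈ N, ∃ c : PadicAlgCl ℓ, ((ρ g : GL (Fin n) (PadicAlgCl ℓ)) :
      Matrix (Fin n) (Fin n) (PadicAlgCl ℓ)) = c • (1 : Matrix (Fin n) (Fin n) (PadicAlgCl ℓ))) :
    ∃ (a d : ℕ) (ρ₁ : FramedGaloisRep K (PadicAlgCl ℓ) a) (ρ₂ : FramedGaloisRep K (PadicAlgCl ℓ) d)
      (Q : GL (Fin n) (PadicAlgCl ℓ)) (e : Fin a × Fin d ≃ Fin n),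
      2 ≤ a ∧ 2 ≤ d ∧ n = a * d ∧ ρ₁.toGaloisRep.IsIrreducible ∧ ρ₂.toGaloisRep.IsIrreducible ∧
      (Set.range (fun g : absoluteGaloisGroup K => (ρ₂ g : GL (Fin d) (PadicAlgCl ℓ)))).Finite ∧
      ∀ g : absoluteGaloisGroup K,
        ((FramedRep.conj Q ρ g : GL (Fin n) (PadicAlgCl ℓ)) : Matrix (Fin n) (Fin n) (PadicAlgCl ℓ)) =
          Matrix.reindex e e
            (((ρ₁ g : GL (Fin a) (PadicAlgCl ℓ)) : Matrix (Fin a) (Fin a) (PadicAlgCl ℓ)) ⊗ₖ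
              ((ρ₂ g : GL (Fin d) (PadicAlgCl ℓ)) : Matrix (Fin d) (Fin d) (PadicAlgCl ℓ))) := by
  classical
  haveI : IsAlgClosed (PadicAlgCl ℓ) := AlgebraicClosure.isAlgClosed _
  set A := PadicAlgCl ℓ with hA
  set π := FramedRep.toRepresentation ρ with hπ
  haveI : π.IsIrreducible := hirr
  -- the Kronecker frame
  obtain ⟨a, d, B, ha, hd, hK1, hK2, hK3, hK4⟩ := exists_kroneckerFrame π N hiso
  -- the multiplicative family `P`
  set P : absoluteGaloisGroup K → Matrix (Fin a × Fin d) (Fin a × Fin d) A :=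
    fun γ => LinearMap.toMatrix B B (π γ) with hP
  have hmul : ∀ γ δ, P (γ * δ) = P γ * P δ := fun γ δ => by
    simp only [hP, map_mul]
    exact LinearMap.toMatrix_mul B (π γ) (π δ)
  have hone : P 1 = 1 := by simp only [hP, map_one]; exact LinearMap.toMatrix_one B
  -- `n = a d`, the relabelling and the frame change
  have had : n = a * d := by
    have h1 := Module.finrank_eq_card_basis B
    rw [Module.finrank_fin_fun, Fintype.card_prod, Fintype.card_fin, Fintype.card_fin] at h1
    exact h1
  let e : Fin a × Fin d ≃ Fin n := Fintype.equivFinOfCardEq (by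
    rw [Fintype.card_prod, Fintype.card_fin, Fintype.card_fin, had])
  obtain ⟨Q, hQ⟩ := Matrix.exists_units_conj_eq_reindex_toMatrix B e
  have hPconj : ∀ γ, ((FramedRep.conj Q ρ γ : GL (Fin n) A) : Matrix (Fin n) (Fin n) A) =
      Matrix.reindex e e (P γ) := fun γ => by
    rw [FramedRep.conj_apply, Units.val_mul, Units.val_mul, ← toMatrix'_toRepresentation ρ γ]
    exact hQ (π γ)
  have hPc : Continuous P := by
    have h1 : P = fun γ => Matrix.reindex e.symm e.symm
        ((FramedRep.conj Q ρ γ : GL (Fin n) A) : Matrix (Fin n) (Fin n) A) := by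
      funext γ
      rw [hPconj, ← Matrix.reindex_symm, Equiv.symm_apply_apply]
    rw [h1]
    exact (Units.continuous_val.comp (FramedRep.conj Q ρ).continuous_toFun).matrix_reindex _ _
  -- the projective factor, trivial on `N`, hence continuous with finite image
  obtain ⟨σ₂, hσ₂, hσ₂N⟩ := exists_projectiveFactor ha hd P hmul hone hK1
  have hσ₂N' : ∀ γ ∈ N, σ₂ γ = 1 := fun γ hγ => hσ₂N γ (hK2 γ hγ)
  let σ₂c : absoluteGaloisGroup K →ₜ* GL (Fin d) A ⧸ Subgroup.center (GL (Fin d) A) :=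
    { toMonoidHom := σ₂
      continuous_toFun := continuous_of_forall_mem_eq_one σ₂ N hNo hσ₂N' }
  have hfin : (Set.range σ₂c).Finite := finite_range_of_forall_mem_eq_one σ₂ N hσ₂N'
  -- Tate's lift
  obtain ⟨ρ₂, hρ₂, hρ₂fin⟩ := exists_framedGaloisRep_lift_of_finite_range K ℓ d σ₂c hfin
  -- `P γ = X' ⊗ ρ₂ γ`
  have hP2 : ∀ γ, ∃ X' : Matrix (Fin a) (Fin a) A,
      P γ = X' ⊗ₖ ((ρ₂.toMonoidHom γ : GL (Fin d) A) : Matrix (Fin d) (Fin d) A) := by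
    intro γ
    obtain ⟨X, Y, hXY, hσγ⟩ := hσ₂ γ
    have h1 : (QuotientGroup.mk Y : GL (Fin d) A ⧸ Subgroup.center (GL (Fin d) A)) =
        QuotientGroup.mk (ρ₂ γ) := by rw [← hσγ, hρ₂ γ]; rfl
    have hmem : Y⁻¹ * ρ₂ γ ∈ Subgroup.center (GL (Fin d) A) := QuotientGroup.eq.1 h1
    rw [Matrix.GeneralLinearGroup.center_eq_range_scalar] at hmem
    obtain ⟨u, hu⟩ := MonoidHom.mem_range.1 hmem
    have h2 : ((ρ₂ γ : GL (Fin d) A) : Matrix (Fin d) (Fin d) A) = (u : A) • (Y : Matrix (Fin d) (Fin d) A) := by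
      rw [eq_inv_mul_iff_mul_eq] at hu
      rw [← hu, Units.val_mul, Matrix.GeneralLinearGroup.coe_scalar, Matrix.scalar_apply,
        ← Matrix.smul_eq_mul_diagonal]
    refine ⟨(u⁻¹ : Aˣ).val • X, ?_⟩
    change P γ = ((u⁻¹ : Aˣ).val • X) ⊗ₖ ((ρ₂ γ : GL (Fin d) A) : Matrix (Fin d) (Fin d) A)
    rw [h2, Matrix.smul_kronecker, Matrix.kronecker_smul, smul_smul, Units.val_inv_eq_inv_val,
      inv_mul_cancel₀ u.ne_zero, one_smul]
    exact hXY
  obtain ⟨ρ₁', hρ₁'⟩ := exists_leftFactor hd P hmul hone ρ₂.toMonoidHom hP2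
  have hρ₁c : Continuous ρ₁' :=
    continuous_leftFactor hd hPc ρ₁' ρ₂.toMonoidHom ρ₂.continuous_toFun hρ₁'
  let ρ₁ : FramedGaloisRep K A a := { toMonoidHom := ρ₁', continuous_toFun := hρ₁c }
  have hXY : ∀ γ, LinearMap.toMatrix B B (π γ) =
      ((ρ₁ γ : GL (Fin a) A) : Matrix (Fin a) (Fin a) A) ⊗ₖ
        ((ρ₂ γ : GL (Fin d) A) : Matrix (Fin d) (Fin d) A) := fun γ => hρ₁' γ
  -- `d ≥ 2`, `a ≥ 2`
  have hd2 : 2 ≤ d := by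
    rcases Nat.lt_or_ge d 2 with h | h
    · exfalso
      have hd1 : d = 1 := by omega
      exact hNirr (hK3 hd1)
    · exact h
  have ha2 : 2 ≤ a := by
    rcases Nat.lt_or_ge a 2 with h | h
    · exfalso
      have ha1 : a = 1 := by omega
      apply hNsc
      intro g hg
      obtain ⟨c, hc⟩ := hK4 ha1 g hg
      refine ⟨c, ?_⟩
      rw [← toMatrix'_toRepresentation ρ g]
      change LinearMap.toMatrix' (π g) = _
      rw [hc, map_smul, LinearMap.toMatrix'_id]
    · exact h
  -- irreducibility of the factors
  have hirr₂ : ρ₂.toGaloisRep.IsIrreducible := by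
    change (FramedRep.toRepresentation ρ₂).IsIrreducible
    exact isIrreducible_toRepresentation_of_forall_submodule hd _ fun W hW =>
      right_factor_irreducible π B _ _ ha hXY W hW
  have hirr₁ : ρ₁.toGaloisRep.IsIrreducible := by
    change (FramedRep.toRepresentation ρ₁).IsIrreducible
    exact isIrreducible_toRepresentation_of_forall_submodule (by omega) _ fun W hW =>
      left_factor_irreducible π B _ _ hd hXY W hW
  refine ⟨a, d, ρ₁, ρ₂, Q, e, ha2, hd2, had, hirr₁, hirr₂, hρ₂fin, fun γ => ?_⟩
  rw [hPconj, hP]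
  exact congrArg _ (hXY γ)

end Summit.Langlands.Langlands.Theorems

end
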